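import Literature.AnabelianGeometry.SemiGraphs.TemperedReconstructionVertexEdgeMapSourceHalvesAt
import Literature.AnabelianGeometry.SemiGraphs.TemperedReconstructionR2bHomProofsAt
import HarnessLib

/-!
# [SemiAnbd] Cor. 3.9 (b) AT ONE PAIR from IMAGE DATA: the vertex and edge maps, hosts, branches and 2-cells,
# with Def. 3.8 + Thm. 3.7 (iv) at the target replaced by «verticial (edge-like) subgroups go onto open subgroups
# of verticial (edge-like) subgroups» and Thm. 3.7 (iii) at the target by its SECOND SENTENCE
# (row «COR39b-ISO@TOP-CYCLIC», file 1/3)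

Mochizuki, *Semi-graphs of anabelioids*, Publ. RIMS **42** (2006), §3, Corollary 3.9, proof, manuscript
pp. 42–43 ("any quasi-geometric morphism … induces a map from the vertices of `G` to the vertices of `H` …
compatible with the map obtained above on vertices"); Theorem 3.7 (iii) pp. 40–41 ("if a nontrivial compact
subgroup is contained in more than one verticial subgroup, then it is contained in precisely two"), (iv) p. 41
[cite: MochizukiSemiAnbd2006, Cor 3.9 pp.42-43].

PROOF-ONLY file (abc-iut cell, layer L3, seat abc-iut-L3-t10 gen 14; 0 definitions, no named fact; L3 lead gen 8
δ14 (2) GO).  The cell's (R1)/(R2) chain for Cor. 3.9 (b) — this lineage's gen-8 `existsUnique_vertexMap/edgeMap_of_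
isQuasiGeometric_halvesAt` (originals abc-iut-L3-t2 / abc-iut-L3-d1) and abc-iut-w4-d083's `exists_branch_of_hostAt`,
`exists_target_branch_commAt`, `host_unique_of_branchAt` — takes at the TARGET `H` the per-graph Thm. 3.7 (iv)
`MaximalCompactIffVerticialAt ℋ` and Thm. 3.7 (iii) `CompactInVerticialAt ℋ`, both of which FAIL on the class
TOP-CYCLIC (rayless star `𝒢⋆(p)`, abc-iut-L3-t8).  READING the proofs: (iv) at `H` and Def. 3.8 for `φ` serve only
to produce the IMAGE DATA

* (himg)  every verticial subgroup of `π₁^temp(G)` maps onto an open subgroup of a verticial subgroup of `π₁^temp(H)`,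
* (himgE) every nontrivial edge-like subgroup maps onto an open subgroup of an edge-like subgroup of `π₁^temp(H)`,

and (iii) at `H` is used only through its SECOND SENTENCE («a nontrivial compact subgroup lying in two distinct
verticial subgroups lies in no third»), which HOLDS on TOP-CYCLIC (`compactInTwoVerticial_of_topCyclic`), on NO-CORE
graphs and at every locally finite graph.  This file re-proves the five theorems VERBATIM with (himg)/(himgE) and that
second sentence AT THE CHART (`hℋiii₂`) as explicit hypotheses (decl suffixes `_of_imagesAt`, `_of_twoVerticialAt`;
uniqueness still by Thm. 3.7 (ii) `VerticialDistinct` and `EdgeLikeDistinctAt ℋ`).  Consumers: files 2–3 of the row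
(`TemperedReconstructionCor39bOfImagesAt`: the locally open morphism and Cor. 3.9 (b) from image data;
`TemperedReconstructionCor39bIsoOfTopCyclic`: the ISO-FORM on TOP-CYCLIC, (iii)/(iv)-free on both sides, image data
by abc-iut-L3-t5's p503472).  Originals untouched; outside the [IUTchIII] Cor. 3.12 cone (every print consumer of
Cor. 3.9 has a finite dual graph); a re-plumbing of OUR per-pair typing, not a claim about print; nothing asserts abc
proved or refuted; typed ≠ proved.
-/

open CategoryTheory Topology

namespace Literature.AnabelianGeometry.SemiGraphs

namespace ProfiniteSemiGraph

universe u

variable {𝒢 ℋ : ProfiniteSemiGraph.{u}}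


/-! ### The vertex map from (himg) -/

/-- **The map on vertices from the image datum (himg)** ([SemiAnbd] Cor. 3.9, proof, p. 42), with Thm. 3.7 (i),
(ii): there is a unique `f_V : V(G) → V(H)` such that every verticial subgroup of `π₁^temp(G)` at `v` maps onto an
open subgroup of some verticial subgroup of `π₁^temp(H)` at `f_V(v)` (twin of
`existsUnique_vertexMap_of_isQuasiGeometric_halvesAt`, the derivation of (himg) from Def. 3.8 and Thm. 3.7 (iv) at
`H` replaced by the hypothesis). [cite: MochizukiSemiAnbd2006, Cor 3.9 p.42] -/
theorem existsUnique_vertexMap_of_imagesAt (h37i : VerticialInjective.{u})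
    (h37ii : VerticialDistinct.{u}) (h𝒢 : 𝒢.Thm37Hypotheses) (hℋ : ℋ.Thm37Hypotheses)
    (c𝒢 : TemperedPiChart 𝒢) (cℋ : TemperedPiChart ℋ) (φ : c𝒢.G →ₜ* cℋ.G)
    (himg : ∀ (v : 𝒢.graph.Vertex) (K : Subgroup c𝒢.G), K ∈ verticialSubgroups c𝒢 v →
      ∃ (w : ℋ.graph.Vertex) (K₂ : Subgroup cℋ.G), K₂ ∈ verticialSubgroups cℋ w ∧
        MapsOntoOpenSubgroupOf φ.toMonoidHom K K₂) :
    ∃! fV : 𝒢.graph.Vertex → ℋ.graph.Vertex,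
      ∀ (v : 𝒢.graph.Vertex) (K : Subgroup c𝒢.G), K ∈ verticialSubgroups c𝒢 v →
        ∃ K₂ ∈ verticialSubgroups cℋ (fV v), MapsOntoOpenSubgroupOf φ.toMonoidHom K K₂ := by
  -- choose, for each `v`, a verticial subgroup and the vertex of its image
  have hne : ∀ v : 𝒢.graph.Vertex, (verticialSubgroups c𝒢 v).Nonempty := fun v => (h37i 𝒢 h𝒢 c𝒢 v).1
  choose K₀ hK₀ using hne
  choose fV K₂ hK₂ hmaps using fun v => himg v (K₀ v) (hK₀ v)
  -- any verticial subgroup at `v` goes to the same vertex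
  have hall : ∀ (v : 𝒢.graph.Vertex) (K : Subgroup c𝒢.G), K ∈ verticialSubgroups c𝒢 v →
      ∃ K₂' ∈ verticialSubgroups cℋ (fV v), MapsOntoOpenSubgroupOf φ.toMonoidHom K K₂' := by
    intro v K hK
    obtain ⟨w, K₂', hK₂', hmaps'⟩ := himg v K hK
    -- `K = g K₀ g⁻¹`, so `φ(K) = φ(g) φ(K₀) φ(g)⁻¹ ≤ φ(g) K₂ φ(g)⁻¹`, verticial at `fV v`
    obtain ⟨g, rfl⟩ := exists_conj_of_mem_verticialSubgroups c𝒢 (hK₀ v) hK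
    have hle : ((K₀ v).map (MulAut.conj g).toMonoidHom).map φ.toMonoidHom ≤
        (K₂ v).map (MulAut.conj (φ g)).toMonoidHom := by
      rintro _ ⟨_, ⟨k, hk, rfl⟩, rfl⟩
      refine ⟨φ k, (hmaps v).1 ⟨k, hk, rfl⟩, ?_⟩
      change φ g * φ k * (φ g)⁻¹ = φ (g * k * g⁻¹)
      rw [map_mul, map_mul, map_inv]
    have hw : w = fV v :=
      vertex_eq_of_mapsOnto_of_le h37ii hℋ cℋ φ.toMonoidHom hK₂' (conj_mem_verticialSubgroups cℋ
        (hK₂ v) (φ g)) hmaps' hle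
    subst hw
    exact ⟨K₂', hK₂', hmaps'⟩
  refine ⟨fV, hall, fun fV' hfV' => funext fun v => ?_⟩
  obtain ⟨K₂', hK₂', hmaps'⟩ := hfV' v (K₀ v) (hK₀ v)
  exact vertex_eq_of_mapsOnto_of_le h37ii hℋ cℋ φ.toMonoidHom hK₂' (hK₂ v) hmaps' (hmaps v).1

/-! ### The edge map from (himgE) -/

/-- **The map on edges from the image datum (himgE)** ([SemiAnbd] Cor. 3.9, proof, p. 42), with Thm. 3.7 (i) and
`EdgeLikeDistinct` AT `ℋ`: there is a unique `f_E : E(G) → E(H)` such that every edge-like subgroup of `π₁^temp(G)`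
at `e` maps onto an open subgroup of some edge-like subgroup of `π₁^temp(H)` at `f_E(e)` (twin of
`existsUnique_edgeMap_of_isQuasiGeometric_halvesAt`). [cite: MochizukiSemiAnbd2006, Cor 3.9 p.42] -/
theorem existsUnique_edgeMap_of_imagesAt (h37i : VerticialInjective.{u}) (hED : EdgeLikeDistinctAt ℋ)
    (h𝒢 : Cor39Hypotheses 𝒢) (hℋ : Cor39Hypotheses ℋ) (c𝒢 : TemperedPiChart 𝒢)
    (cℋ : TemperedPiChart ℋ) (φ : c𝒢.G →ₜ* cℋ.G)
    (himgE : ∀ (e : 𝒢.graph.Edge) (L : Subgroup c𝒢.G), L ∈ edgeLikeSubgroups c𝒢 e → L ≠ ⊥ →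
      ∃ (e' : ℋ.graph.Edge) (L₂ : Subgroup cℋ.G), L₂ ∈ edgeLikeSubgroups cℋ e' ∧
        MapsOntoOpenSubgroupOf φ.toMonoidHom L L₂) :
    ∃! fE : 𝒢.graph.Edge → ℋ.graph.Edge,
      ∀ (e : 𝒢.graph.Edge) (L : Subgroup c𝒢.G), L ∈ edgeLikeSubgroups c𝒢 e →
        ∃ L₂ ∈ edgeLikeSubgroups cℋ (fE e), MapsOntoOpenSubgroupOf φ.toMonoidHom L L₂ := by
  -- choose, for each edge, a nontrivial edge-like subgroup and the edge of its image
  choose L₀ hL₀ hL₀0 using fun e => exists_mem_edgeLikeSubgroups_ne_bot h37i h𝒢 c𝒢 e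
  choose fE L₂ hL₂ hmaps using fun e => himgE e (L₀ e) (hL₀ e) (hL₀0 e)
  -- any edge-like subgroup at `e` goes to the same edge
  have hall : ∀ (e : 𝒢.graph.Edge) (L : Subgroup c𝒢.G), L ∈ edgeLikeSubgroups c𝒢 e →
      ∃ L₂' ∈ edgeLikeSubgroups cℋ (fE e), MapsOntoOpenSubgroupOf φ.toMonoidHom L L₂' := by
    intro e L hL
    obtain ⟨g, rfl⟩ := exists_conj_of_mem_edgeLikeSubgroups c𝒢 (hL₀ e) hL
    have hL0 : (L₀ e).map (MulAut.conj g).toMonoidHom ≠ ⊥ := fun h0 =>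
      hL₀0 e ((Subgroup.map_eq_bot_iff_of_injective _ (MulAut.conj g).injective).mp h0)
    obtain ⟨e', L₂', hL₂', hmaps'⟩ := himgE e _ hL hL0
    have hle : ((L₀ e).map (MulAut.conj g).toMonoidHom).map φ.toMonoidHom ≤
        (L₂ e).map (MulAut.conj (φ g)).toMonoidHom := by
      rintro _ ⟨_, ⟨k, hk, rfl⟩, rfl⟩
      refine ⟨φ k, (hmaps e).1 ⟨k, hk, rfl⟩, ?_⟩
      change φ g * φ k * (φ g)⁻¹ = φ (g * k * g⁻¹)
      rw [map_mul, map_mul, map_inv]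
    have he : e' = fE e :=
      edge_eq_of_mapsOnto_of_le_at hED hℋ.thm37Hypotheses cℋ φ.toMonoidHom hL₂'
        (conj_mem_edgeLikeSubgroups' cℋ (hL₂ e) (φ g)) hmaps' hle
    subst he
    exact ⟨L₂', hL₂', hmaps'⟩
  refine ⟨fE, hall, fun fE' hfE' => funext fun e => ?_⟩
  obtain ⟨L₂', hL₂', hmaps'⟩ := hfE' e (L₀ e) (hL₀ e)
  exact edge_eq_of_mapsOnto_of_le_at hED hℋ.thm37Hypotheses cℋ φ.toMonoidHom hL₂' (hL₂ e) hmaps'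
    (hmaps e).1


/-! ### The host of the image of an edge group singles out a branch (Thm 3.7 (ii), (iii) sentence 2 AT `ℋ`) -/

/-- **Core step of [SemiAnbd] Cor. 3.9, p. 267 «compatible with the map obtained above on vertices», AT
the graph `ℋ`** (twin of `exists_branch_of_hostAt` with Thm 3.7 (iii) at `ℋ` weakened to its SECOND SENTENCE at
the chart, hypothesis `hℋiii₂`). Let `χ` be an edge
homomorphism of `H` at a (closed) edge `e'`, `M ≠ 1` a compact subgroup of its range, and `W` a verticial
subgroup at `w` containing `M`. Then `W` is the host of `range χ` through one of the two branches `b'` of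
`e'`, this branch abuts to `w`, and `Ψ_w ∘ b'_*` is conjugate to `χ` by an element `k` with
`W = k⁻¹·Ψ_w(Π_w)·k`. [cite: MochizukiSemiAnbd2006, Cor 3.9 p.42] -/
theorem exists_branch_of_host_of_twoVerticialAt (h37i : VerticialInjective.{u})
    (h37ii : VerticialDistinct.{u}) (hℋ : Cor39Hypotheses ℋ) (c : TemperedPiChart ℋ)
    (hℋiii₂ : ∀ (C : Subgroup c.G), IsCompact (C : Set c.G) → C ≠ ⊥ →
      ∀ (v₁ v₂ : ℋ.graph.Vertex) (H₁ H₂ : Subgroup c.G), H₁ ∈ verticialSubgroups c v₁ →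
        H₂ ∈ verticialSubgroups c v₂ → H₁ ≠ H₂ → C ≤ H₁ → C ≤ H₂ →
          ∀ (v₃ : ℋ.graph.Vertex) (H₃ : Subgroup c.G), H₃ ∈ verticialSubgroups c v₃ → C ≤ H₃ →
            H₃ = H₁ ∨ H₃ = H₂)
    (Ψ : ∀ w : ℋ.graph.Vertex, ℋ.Gv w →ₜ* c.G) (hΨ : ∀ w, IsVerticialHom c w (Ψ w))
    {e' : ℋ.graph.Edge} (χ : ℋ.Ge e' →ₜ* c.G) (hχ : IsEdgeHom c e' χ)
    {M : Subgroup c.G} (hME : M ≤ χ.toMonoidHom.range) (hMc : IsCompact (M : Set c.G))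
    (hMne : M ≠ ⊥) {w : ℋ.graph.Vertex} {W : Subgroup c.G} (hW : W ∈ verticialSubgroups c w)
    (hMW : M ≤ W) :
    ∃ (b' : ℋ.graph.Branch) (q : ℋ.graph.edgeOf b' = e') (h' : ℋ.graph.abuts b' = some w) (k : c.G),
      (∀ y, k * χ y * k⁻¹ = Ψ w (ℋ.brHomAt b' w h' e' q y)) ∧
        W = (Ψ w).toMonoidHom.range.map (MulAut.conj k⁻¹).toMonoidHom := by
  classical
  have hℋ37 := hℋ.thm37Hypotheses
  obtain ⟨b₁, b₂, w₁, w₂, hb12, q₁, q₂, h₁, h₂⟩ :=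
    SemiGraph.exists_branches_of_isClosedEdge (isClosedEdge_of_isGraph hℋ.isGraph e')
  obtain ⟨k₁, hk₁⟩ := exists_conj_comp_brHomAt c h₁ (Ψ w₁) (hΨ w₁) q₁ χ hχ
  obtain ⟨k₂, hk₂⟩ := exists_conj_comp_brHomAt c h₂ (Ψ w₂) (hΨ w₂) q₂ χ hχ
  -- `range χ = kᵢ⁻¹ · Ψ(Π_{bᵢ}) · kᵢ`
  have hEle : ∀ {b : ℋ.graph.Branch} {u : ℋ.graph.Vertex} (hb : ℋ.graph.abuts b = some u)
      (q : ℋ.graph.edgeOf b = e') (k : c.G),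
      (∀ y, k * χ y * k⁻¹ = Ψ u (ℋ.brHomAt b u hb e' q y)) →
        χ.toMonoidHom.range ≤
          ((ℋ.branchSubgroup b u hb).map (Ψ u).toMonoidHom).map (MulAut.conj k⁻¹).toMonoidHom := by
    intro b u hb q k hk
    rintro _ ⟨y, rfl⟩
    refine ⟨Ψ u (ℋ.brHomAt b u hb e' q y), ⟨_, brHomAt_mem_branchSubgroup hb q y, rfl⟩, ?_⟩
    have hy : χ y = k⁻¹ * Ψ u (ℋ.brHomAt b u hb e' q y) * k⁻¹⁻¹ := by
      rw [← hk y]; group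
    rw [MulEquiv.coe_toMonoidHom, MulAut.conj_apply, ContinuousMonoidHom.coe_toMonoidHom]
    exact hy.symm
  have hE₁ := hEle h₁ q₁ k₁ hk₁
  have hE₂ := hEle h₂ q₂ k₂ hk₂
  have hH₁ : (Ψ w₁).toMonoidHom.range.map (MulAut.conj k₁⁻¹).toMonoidHom ∈ verticialSubgroups c w₁ :=
    conj_mem_verticialSubgroups c (range_mem_verticialSubgroups c (Ψ w₁) (hΨ w₁)) k₁⁻¹
  have hH₂ : (Ψ w₂).toMonoidHom.range.map (MulAut.conj k₂⁻¹).toMonoidHom ∈ verticialSubgroups c w₂ :=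
    conj_mem_verticialSubgroups c (range_mem_verticialSubgroups c (Ψ w₂) (hΨ w₂)) k₂⁻¹
  have hEH₁ : χ.toMonoidHom.range ≤ (Ψ w₁).toMonoidHom.range.map (MulAut.conj k₁⁻¹).toMonoidHom :=
    hE₁.trans (Subgroup.map_mono (Subgroup.map_le_range _ _))
  have hEH₂ : χ.toMonoidHom.range ≤ (Ψ w₂).toMonoidHom.range.map (MulAut.conj k₂⁻¹).toMonoidHom :=
    hE₂.trans (Subgroup.map_mono (Subgroup.map_le_range _ _))
  have hEne : χ.toMonoidHom.range ≠ ⊥ := fun h0 => hMne (le_bot_iff.mp (h0 ▸ hME))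
  -- the two hosts are distinct (total estrangement, via `branch_eq_of_hosts_eq`)
  have hne : (Ψ w₁).toMonoidHom.range.map (MulAut.conj k₁⁻¹).toMonoidHom ≠
      (Ψ w₂).toMonoidHom.range.map (MulAut.conj k₂⁻¹).toMonoidHom := fun hEq =>
    hb12 (branch_eq_of_hosts_eq h37ii h37i hℋ37 c Ψ hΨ hEne h₁ h₂ k₁⁻¹ k₂⁻¹ hE₁ hE₂ hEq)
  -- Thm 3.7 (iii) AT `ℋ`: `M` has exactly these two hosts
  have honly := hℋiii₂ M hMc hMne w₁ w₂ _ _ hH₁ hH₂ hne (hME.trans hEH₁) (hME.trans hEH₂)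
  rcases honly w W hW hMW with hW₁ | hW₂
  · have hw : w = w₁ := by
      by_contra hne'
      have h0 := (h37ii ℋ hℋ37 c).1 w w₁ W _ hW hH₁ hne'
      rw [hW₁, Subgroup.relIndex_self] at h0
      exact one_ne_zero h0
    subst hw
    exact ⟨b₁, q₁, h₁, k₁, hk₁, hW₁⟩
  · have hw : w = w₂ := by
      by_contra hne'
      have h0 := (h37ii ℋ hℋ37 c).1 w w₂ W _ hW hH₂ hne'
      rw [hW₂, Subgroup.relIndex_self] at h0
      exact one_ne_zero h0
    subst hw
    exact ⟨b₂, q₂, h₂, k₂, hk₂, hW₂⟩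

/-- Composition of two conjugations. [folklore] -/
private theorem conj_toMonoidHom_comp'' {G : Type*} [Group G] (x y : G) :
    (MulAut.conj x).toMonoidHom.comp (MulAut.conj y).toMonoidHom = (MulAut.conj (x * y)).toMonoidHom := by
  ext z; simp [mul_assoc]

/-- **Compatibility at a branch, AT the graph `ℋ`** (twin of `exists_target_branch_commAt`, Thm 3.7 (iii) at `ℋ`
weakened to its second sentence `hℋiii₂`; [SemiAnbd] Cor. 3.9, proof, p. 268 «induces … compatible with the
`b_*` up to inner automorphism»): given the lifts
`hV : Π_v → Π_w` (through the verticial `χ_v` at `w`) and `hE : Π_e → Π_{e'}` (through the edge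
homomorphism `χ_E` at `e'`) of `φ ∘ ψ_v`, `φ ∘ ψ_E`, and `a` with `ψ_v ∘ b_* = γ_a ∘ ψ_E`, there is a
branch `b'` of `e'` abutting to `w` and `γ ∈ Π_w` with `hV ∘ b_* = γ_γ ∘ b'_* ∘ hE`; moreover the host
`(φ a)⁻¹·χ_v(Π_w)·(φ a)` of the image of the edge group is the host of `range χ_E` through `b'`.  Only the
second sentence of Thm 3.7 (iii) at `ℋ` is used. [cite: MochizukiSemiAnbd2006, Cor 3.9 p.43] -/
theorem exists_target_branch_comm_of_twoVerticialAt (h37i : VerticialInjective.{u})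
    (h37ii : VerticialDistinct.{u}) (hℋ : Cor39Hypotheses ℋ)
    (c𝒢 : TemperedPiChart 𝒢) (cℋ : TemperedPiChart ℋ)
    (hℋiii₂ : ∀ (C : Subgroup cℋ.G), IsCompact (C : Set cℋ.G) → C ≠ ⊥ →
      ∀ (v₁ v₂ : ℋ.graph.Vertex) (H₁ H₂ : Subgroup cℋ.G), H₁ ∈ verticialSubgroups cℋ v₁ →
        H₂ ∈ verticialSubgroups cℋ v₂ → H₁ ≠ H₂ → C ≤ H₁ → C ≤ H₂ →
          ∀ (v₃ : ℋ.graph.Vertex) (H₃ : Subgroup cℋ.G), H₃ ∈ verticialSubgroups cℋ v₃ → C ≤ H₃ →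
            H₃ = H₁ ∨ H₃ = H₂)
    (φ : c𝒢.G →ₜ* cℋ.G)
    (Ψ : ∀ w : ℋ.graph.Vertex, ℋ.Gv w →ₜ* cℋ.G) (hΨ : ∀ w, IsVerticialHom cℋ w (Ψ w))
    {v : 𝒢.graph.Vertex} (ψv : 𝒢.Gv v →ₜ* c𝒢.G)
    {w : ℋ.graph.Vertex} (χv : ℋ.Gv w →ₜ* cℋ.G) (hχv : IsVerticialHom cℋ w χv)
    (hVv : 𝒢.Gv v →ₜ* ℋ.Gv w) (hhV : ∀ y, χv (hVv y) = φ (ψv y))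
    {b : 𝒢.graph.Branch} (hb : 𝒢.graph.abuts b = some v)
    (ψE : 𝒢.Ge (𝒢.graph.edgeOf b) →ₜ* c𝒢.G) (a : c𝒢.G)
    (ha : ∀ x, a * ψE x * a⁻¹ = ψv (𝒢.brHom b v hb x))
    {e' : ℋ.graph.Edge} (χE : ℋ.Ge e' →ₜ* cℋ.G) (hχE : IsEdgeHom cℋ e' χE)
    (hEe : 𝒢.Ge (𝒢.graph.edgeOf b) →ₜ* ℋ.Ge e') (hhE : ∀ x, χE (hEe x) = φ (ψE x))
    (hmaps : MapsOntoOpenSubgroupOf φ.toMonoidHom ψE.toMonoidHom.range χE.toMonoidHom.range) :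
    ∃ (b' : ℋ.graph.Branch) (q : ℋ.graph.edgeOf b' = e') (h' : ℋ.graph.abuts b' = some w)
      (k : cℋ.G) (γ : ℋ.Gv w),
      (∀ y, k * χE y * k⁻¹ = Ψ w (ℋ.brHomAt b' w h' e' q y)) ∧
      χv.toMonoidHom.range.map (MulAut.conj (φ a)⁻¹).toMonoidHom =
        (Ψ w).toMonoidHom.range.map (MulAut.conj k⁻¹).toMonoidHom ∧
      ∀ x, hVv (𝒢.brHom b v hb x) = γ * ℋ.brHomAt b' w h' e' q (hEe x) * γ⁻¹ := by
  classical
  haveI := TemperedPiChart.t2Space cℋ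
  have hℋ37 := hℋ.thm37Hypotheses
  -- the image `M` of the edge group
  set M : Subgroup cℋ.G := ψE.toMonoidHom.range.map φ.toMonoidHom with hMdef
  have hME : M ≤ χE.toMonoidHom.range := hmaps.1
  have hMc : IsCompact (M : Set cℋ.G) := by
    have : (M : Set cℋ.G) = Set.range (fun x => φ (ψE x)) := by
      ext z
      simp only [hMdef, Subgroup.coe_map, MonoidHom.coe_range, Set.mem_image, Set.mem_range,
        exists_exists_eq_and]
      rfl
    rw [this]
    exact isCompact_range (φ.continuous.comp ψE.continuous)
  have hEmem : χE.toMonoidHom.range ∈ edgeLikeSubgroups cℋ e' := ⟨χE, hχE, rfl⟩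
  have hMne : M ≠ ⊥ := by
    intro h0
    have h1 := relIndex_ne_zero_of_mapsOnto φ.toMonoidHom (isCompact_of_mem_edgeLikeSubgroups cℋ hEmem) hmaps
    rw [← hMdef, h0, Subgroup.relIndex_bot_left] at h1
    haveI := infinite_of_mem_edgeLikeSubgroups h37i hℋ37 cℋ hEmem
    exact h1 Nat.card_eq_zero_of_infinite
  -- `M` lies in the verticial `(φ a)⁻¹ · χv(Π_w) · (φ a)`
  have hW : χv.toMonoidHom.range.map (MulAut.conj (φ a)⁻¹).toMonoidHom ∈ verticialSubgroups cℋ w :=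
    conj_mem_verticialSubgroups cℋ (range_mem_verticialSubgroups cℋ χv hχv) _
  have hMW : M ≤ χv.toMonoidHom.range.map (MulAut.conj (φ a)⁻¹).toMonoidHom := by
    rintro _ ⟨_, ⟨x, rfl⟩, rfl⟩
    refine ⟨φ a * φ (ψE x) * (φ a)⁻¹, ⟨hVv (𝒢.brHom b v hb x), ?_⟩, ?_⟩
    · show χv (hVv (𝒢.brHom b v hb x)) = _
      rw [hhV, ← ha, map_mul, map_mul, map_inv]
    · show (φ a)⁻¹ * (φ a * φ (ψE x) * (φ a)⁻¹) * (φ a)⁻¹⁻¹ = φ (ψE x)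
      group
  obtain ⟨b', q, h', k, hk, hhost⟩ :=
    exists_branch_of_host_of_twoVerticialAt h37i h37ii hℋ cℋ hℋiii₂ Ψ hΨ χE hχE hME hMc hMne hW hMW
  -- `χv = γ_d ∘ Ψ_w`
  obtain ⟨d, hd⟩ := exists_conj_of_isVerticialHom cℋ (Ψ w) χv (hΨ w) hχv
  have hrange : χv.toMonoidHom.range = (Ψ w).toMonoidHom.range.map (MulAut.conj d).toMonoidHom :=
    range_eq_map_conj_of_conj_eq cℋ (Ψ w) χv d hd
  -- commensurable terminality: `d⁻¹ (φ a) k⁻¹ ∈ Ψ_w(Π_w)`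
  have hmem : ((φ a)⁻¹ * d)⁻¹ * k⁻¹ ∈ (Ψ w).toMonoidHom.range := by
    by_contra hn
    have h0 := (h37ii ℋ hℋ37 cℋ).2 w _ (range_mem_verticialSubgroups cℋ (Ψ w) (hΨ w)) _ _ hn
    have heq : (Ψ w).toMonoidHom.range.map (MulAut.conj ((φ a)⁻¹ * d)).toMonoidHom =
        (Ψ w).toMonoidHom.range.map (MulAut.conj k⁻¹).toMonoidHom := by
      rw [← conj_toMonoidHom_comp'', ← Subgroup.map_map, ← hrange, hhost]
    rw [heq, Subgroup.relIndex_self] at h0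
    exact one_ne_zero h0
  obtain ⟨p, hp⟩ := hmem
  have hp' : Ψ w p = d⁻¹ * φ a * k⁻¹ := by
    rw [show Ψ w p = (Ψ w).toMonoidHom p from rfl, hp]; group
  have hinj : Function.Injective χv := (h37i ℋ hℋ37 cℋ w).2 χv hχv
  refine ⟨b', q, h', k, p, hk, hhost, fun x => hinj ?_⟩
  rw [hhV, ← ha, map_mul, map_mul, map_inv, ← hhE, map_mul, map_mul, map_inv, ← hd p, hp',
    ← hd (ℋ.brHomAt b' w h' e' q (hEe x)), ← hk]
  group

/-- **Host of an edge-like subgroup through a branch is well defined, AT the graph `ℋ`** (twin of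
`host_unique_of_branchAt`; the second sentence of [SemiAnbd] Thm 3.7 (iii) p. 41, hypothesis `hℋiii₂`, with total
estrangement): if `Ψ_w(Π_{b'})`
contains both `k₁·E·k₁⁻¹` and `k₂·E·k₂⁻¹` for the range `E` of an edge homomorphism at `edgeOf b'`,
then `k₁⁻¹·Ψ_w(Π_w)·k₁ = k₂⁻¹·Ψ_w(Π_w)·k₂`. [cite: MochizukiSemiAnbd2006, Thm 3.7(iii) p.41] -/
theorem host_unique_of_branch_of_twoVerticialAt (h37i : VerticialInjective.{u})
    (h37ii : VerticialDistinct.{u}) (hℋ : Cor39Hypotheses ℋ) (c : TemperedPiChart ℋ)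
    (hℋiii₂ : ∀ (C : Subgroup c.G), IsCompact (C : Set c.G) → C ≠ ⊥ →
      ∀ (v₁ v₂ : ℋ.graph.Vertex) (H₁ H₂ : Subgroup c.G), H₁ ∈ verticialSubgroups c v₁ →
        H₂ ∈ verticialSubgroups c v₂ → H₁ ≠ H₂ → C ≤ H₁ → C ≤ H₂ →
          ∀ (v₃ : ℋ.graph.Vertex) (H₃ : Subgroup c.G), H₃ ∈ verticialSubgroups c v₃ → C ≤ H₃ →
            H₃ = H₁ ∨ H₃ = H₂)
    (Ψ : ∀ w : ℋ.graph.Vertex, ℋ.Gv w →ₜ* c.G) (hΨ : ∀ w, IsVerticialHom c w (Ψ w))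
    {e' : ℋ.graph.Edge} (χ : ℋ.Ge e' →ₜ* c.G) (hχ : IsEdgeHom c e' χ)
    {w : ℋ.graph.Vertex} {b' : ℋ.graph.Branch} (h' : ℋ.graph.abuts b' = some w)
    (q : ℋ.graph.edgeOf b' = e') (k₁ k₂ : c.G)
    (hk₁ : χ.toMonoidHom.range.map (MulAut.conj k₁).toMonoidHom ≤
      (ℋ.branchSubgroup b' w h').map (Ψ w).toMonoidHom)
    (hk₂ : χ.toMonoidHom.range.map (MulAut.conj k₂).toMonoidHom ≤
      (ℋ.branchSubgroup b' w h').map (Ψ w).toMonoidHom) :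
    (Ψ w).toMonoidHom.range.map (MulAut.conj k₁⁻¹).toMonoidHom =
      (Ψ w).toMonoidHom.range.map (MulAut.conj k₂⁻¹).toMonoidHom := by
  classical
  haveI := TemperedPiChart.t2Space c
  have hℋ37 := hℋ.thm37Hypotheses
  have hEmem : χ.toMonoidHom.range ∈ edgeLikeSubgroups c e' := ⟨χ, hχ, rfl⟩
  haveI := infinite_of_mem_edgeLikeSubgroups h37i hℋ37 c hEmem
  have hEne : χ.toMonoidHom.range ≠ ⊥ := fun h0 => by
    rw [h0] at hEmem
    haveI := infinite_of_mem_edgeLikeSubgroups h37i hℋ37 c hEmem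
    exact not_finite (⊥ : Subgroup c.G)
  have hEc : IsCompact ((χ.toMonoidHom.range : Subgroup c.G) : Set c.G) :=
    isCompact_of_mem_edgeLikeSubgroups c hEmem
  -- `E ≤ kⱼ⁻¹ · Ψ(Π_{b'}) · kⱼ`
  have hle : ∀ k : c.G, χ.toMonoidHom.range.map (MulAut.conj k).toMonoidHom ≤
      (ℋ.branchSubgroup b' w h').map (Ψ w).toMonoidHom →
      χ.toMonoidHom.range ≤ ((ℋ.branchSubgroup b' w h').map (Ψ w).toMonoidHom).map
        (MulAut.conj k⁻¹).toMonoidHom := by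
    intro k hk x hx
    refine ⟨k * x * k⁻¹, hk ⟨x, hx, rfl⟩, ?_⟩
    simp only [MulEquiv.coe_toMonoidHom, MulAut.conj_apply]
    group
  have hE₁ := hle k₁ hk₁
  have hE₂ := hle k₂ hk₂
  set W₁ := (Ψ w).toMonoidHom.range.map (MulAut.conj k₁⁻¹).toMonoidHom with hW₁def
  set W₂ := (Ψ w).toMonoidHom.range.map (MulAut.conj k₂⁻¹).toMonoidHom with hW₂def
  have hW₁ : W₁ ∈ verticialSubgroups c w :=
    conj_mem_verticialSubgroups c (range_mem_verticialSubgroups c (Ψ w) (hΨ w)) k₁⁻¹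
  have hW₂ : W₂ ∈ verticialSubgroups c w :=
    conj_mem_verticialSubgroups c (range_mem_verticialSubgroups c (Ψ w) (hΨ w)) k₂⁻¹
  have hEW₁ : χ.toMonoidHom.range ≤ W₁ := hE₁.trans (Subgroup.map_mono (Subgroup.map_le_range _ _))
  have hEW₂ : χ.toMonoidHom.range ≤ W₂ := hE₂.trans (Subgroup.map_mono (Subgroup.map_le_range _ _))
  by_contra hne
  -- the other branch of `e'`
  obtain ⟨c₁, c₂, hc12, hc₁, hc₂, hall⟩ := ℋ.graph.two_branches e'
  obtain ⟨b'', hbb, q''⟩ : ∃ b'', b'' ≠ b' ∧ ℋ.graph.edgeOf b'' = e' := by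
    rcases hall b' q with rfl | rfl
    · exact ⟨c₂, hc12.symm, hc₂⟩
    · exact ⟨c₁, hc12, hc₁⟩
  obtain ⟨w'', h''⟩ := Option.isSome_iff_exists.mp (hℋ.isGraph.abuts_isSome b'')
  obtain ⟨k'', hk''⟩ := exists_conj_comp_brHomAt c h'' (Ψ w'') (hΨ w'') q'' χ hχ
  have hE'' : χ.toMonoidHom.range ≤ ((ℋ.branchSubgroup b'' w'' h'').map (Ψ w'').toMonoidHom).map
      (MulAut.conj k''⁻¹).toMonoidHom := by
    rintro _ ⟨y, rfl⟩
    refine ⟨Ψ w'' (ℋ.brHomAt b'' w'' h'' e' q'' y), ⟨_, brHomAt_mem_branchSubgroup h'' q'' y, rfl⟩, ?_⟩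
    have hy : χ y = k''⁻¹ * Ψ w'' (ℋ.brHomAt b'' w'' h'' e' q'' y) * k''⁻¹⁻¹ := by
      rw [← hk'' y]; group
    rw [MulEquiv.coe_toMonoidHom, MulAut.conj_apply, ContinuousMonoidHom.coe_toMonoidHom]
    exact hy.symm
  have hW'' : ((Ψ w'').toMonoidHom.range.map (MulAut.conj k''⁻¹).toMonoidHom) ∈ verticialSubgroups c w'' :=
    conj_mem_verticialSubgroups c (range_mem_verticialSubgroups c (Ψ w'') (hΨ w'')) k''⁻¹
  have hEW'' : χ.toMonoidHom.range ≤ (Ψ w'').toMonoidHom.range.map (MulAut.conj k''⁻¹).toMonoidHom :=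
    hE''.trans (Subgroup.map_mono (Subgroup.map_le_range _ _))
  -- Thm 3.7 (iii) AT `ℋ` applied to `E` with hosts `W₁ ≠ W₂`
  have honly := hℋiii₂ _ hEc hEne w w W₁ W₂ hW₁ hW₂ hne hEW₁ hEW₂
  rcases honly w'' _ hW'' hEW'' with h1 | h2
  · exact hbb (branch_eq_of_hosts_eq h37ii h37i hℋ37 c Ψ hΨ hEne h'' h' k''⁻¹ k₁⁻¹ hE'' hE₁ h1)
  · exact hbb (branch_eq_of_hosts_eq h37ii h37i hℋ37 c Ψ hΨ hEne h'' h' k''⁻¹ k₂⁻¹ hE'' hE₂ h2)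

end ProfiniteSemiGraph

end Literature.AnabelianGeometry.SemiGraphs
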